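import Summits.Ventures.CertifiedManyBodySolver.Downfold.TPrimePinnedPairRowKernelWide
import Summits.Ventures.CertifiedManyBodySolver.Downfold.PinnedPairTPrimeOfResidPolys
import HarnessLib

/-!
# PINNED `t′`-PAIR nodes‴ (WN shapes) from window identities / semantic residuals on a LARGER LETTER WINDOW `Λ' ⊇ box 2 7` — the WIDE twins of
# p667540 (`…of_window_certificates`) and p673872 (`…of_residPolys`), BY IMPORT of hubbard-cov-la214-unc-2's bridge `expect_d4Emb_fermionEmbed_incl`

Venture CertifiedManyBodySolver; cell `hubbard-obs` / D-0154 (1)(C) COVERAGE; seat `hubbard-cov-la214-box-2` (g3); captain hubbard-cov-la214-plan-1 g3 ACK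
(hubbard-obs STATUS 2026-08-28T23:20:40Z: «one bridge writer = unc-2 (you import it), ONE WN file …Wide»). WHY (hubbard-cov-la214-unc-2 FINDING 2026-08-28T23:18:46Z,
same on the WN side): the WN pair SHAPES read the objective on `box 2 7` (`tPrimeObjOrbitMean X s ω`, p662147 / p662965) and every WN link so far (p667540 /
p669208 / p673872 / p675284) takes letters `d : _ → Orb (PolySite (box 2 7))`, while the exporter's instances live on a larger outer table (`BoxGeom.boxQuot 6 12 6`,
N = 625, hubbard-obs-p2 2026-08-28T23:16:41Z). A certificate on `Λ' ⊇ box 2 7` proves its identity in `𝔄_{Λ'}` with the objective the EMBEDDED word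
`Γ(incl h7)(X s_v)`; the shape's `box 2 7` orbit means are recovered by the bridge (embedding algebra + compatibility of the local functionals; no new mathematics).

* `TPrimePinnedPairFamilyRowWN.of_window_certificates_wide` — p667540's theorem with the two identities in `𝔄_{Λ'}` (any `Λ' ⊇ box 2 7`, `Λ ⊆ Λ'`, `thicken Λ 1 ⊆ Λ'`,
  `thicken {0} 1 ⊆ Λ'`), objectives `fermionEmbed (PolySite.incl h7) (X s_v)`; proof = p667540's (hubbard-cov-la214-unc-2's generic `pinnedVertexRow_of_windowIdentity` /
  `pinnedStationarity` at `Λ'`) + `simp_rw [expect_d4Emb_fermionEmbed_incl ω h7]` on the objective orbit mean.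
* `TPrimePinnedPairFamilyRowWN.of_residPolys_wide` / `TPrimePinnedPairRowWN.of_residPolys_wide` — p673872's semantic-residual entries with letters `d : α → Orb (PolySite Λ')`,
  dictionaries on `Λ'`, `hX_v : termOp d TX_v = fermionEmbed (PolySite.incl h7) (X s_v)` (resp. `… X₀`), abstract Gram slots; hubbard-obs-p2's `windowIdentity_of_residPoly`
  is `Λ'`-generic already. The chain / hinted-quotient / `stepEQA` WIDE twins are 3-line corollaries (next file).

HONEST FRAMING: Lean plumbing; evaluates nothing, discharges NO node; no number of record / tier / hold / box word / registry row changes (M2(c) `_cQ` p660755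
unchanged); CONTROL / CALIBRATION class (wording (xx1)); a ceiling never speaks to the presence of superconductivity or to `ρ_s = 0`; no `T_c` / phase sentence; nothing
about La₁.₈₇₅Sr₀.₁₂₅CuO₄ samples; no item, rung leaf or summit statement is proved here. Zero compute.

References: J. Wang et al., PRX 14 (2024) 031006, §III [cite: WangEtAl2024, §III]; S. Boyd, L. Vandenberghe, *Convex Optimization* (2004) §5.9
[cite: BoydVandenberghe2004, §5.9]; C. Jansson, D. Chaykin, C. Keil, SIAM J. Numer. Anal. 46 (2008) 180, §3 [cite: JanssonChaykinKeil2008, §3].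
-/

noncomputable section

namespace Summit.Ventures.CertifiedManyBodySolver.Downfold

open Set Filter Topology Finset
open Literature.MathematicalPhysics.QuantumLattice Literature.MathematicalPhysics.QuantumLattice.ThermodynamicLimit
open Literature.MathematicalPhysics.QuantumLattice.InfVolFermionState
open Literature.MathematicalPhysics.QuantumManyBody.StateRelaxation
open Literature.Probability.LatticeModels
open Matrix HubbardWave0
open Summit.Ventures.CertifiedQuantumChemistry Summit.Ventures.CertifiedQuantumChemistry.CARPoly
open Summit.Ventures.CertifiedManyBodySolver.CARPolyWindow
open scoped BigOperators ComplexOrder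

/-! ## §1 Identity level, wide window -/

section IdentityWide

/-- **WN-FAMILY PAIR NODE‴ ⇐ TWO WINDOW IDENTITIES ON A LARGER WINDOW `Λ' ⊇ box 2 7` sharing the eom words** (objectives `Γ(incl h7)(X s_v)`); the shape's
`box 2 7` orbit means by `expect_d4Emb_fermionEmbed_incl`. [cite: WangEtAl2024, §III] [cite: BoydVandenberghe2004, §5.9] -/
theorem TPrimePinnedPairFamilyRowWN.of_window_certificates_wide
    {U : ℝ} (hU : 0 ≤ U) {sA sB : ℝ}
    (X : ℝ → FermionOp (Literature.Probability.LatticeModels.box 2 7))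
    {Λ Λ' : Finset (Site 2)} (h7 : Literature.Probability.LatticeModels.box 2 7 ⊆ Λ') (hΛ : Λ ⊆ Λ')
    (h8 : thicken Λ 1 ⊆ Λ')
    (h0 : thicken ({0} : Finset (Site 2)) 1 ⊆ Λ')
    (hz : (0 : Site 2) ∈ Λ')
    -- the SHARED equation-of-motion family
    {κ' : Type*} (sE : Finset κ') (B : κ' → FermionOp Λ)
    -- the pair slots
    {cA cB flA flB βA κA κA' slA βB κB κB' slB n₀ : ℚ}
    -- vertex A
    (μA : Fin 2 → ℝ) (νA : ℝ)
    {mA : Type*} [Fintype mA] [DecidableEq mA] {ΛmA : Matrix mA mA ℂ} (hΛmA : ΛmA.PosSemidef)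
    (OA : mA → FermionOp Λ')
    {ιA : Type*} (ttA : Finset ιA) (γA : ιA → DihedralGroup 4) (wvA : ιA → Site 2)
    (hshA : ∀ l, d4ShiftSet (γA l) (wvA l) Λ ⊆ Λ') (YA : ιA → FermionOp Λ)
    {ρA : Type*} (uuA : Finset ρA) (bA : ρA → ℂ) (cwA : ρA → List (Orb (PolySite Λ') × Bool))
    (hcwA : ∀ j ∈ uuA, ladderCharge (cwA j) ≠ 0 ∨ ladderSpinCharge (cwA j) ≠ 0)
    {δA : Type*} (ahA : Finset δA) (dcA : δA → ℝ) (VA : δA → FermionOp Λ')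
    {κA'' : Type*} (wA : Finset κA'') (aA : κA'' → ℂ) (wordA : κA'' → List (Orb (PolySite Λ') × Bool))
    {c0A : ℝ}
    (hcertA : fermionEmbed (PolySite.incl h7) (X sA) - (c0A : ℂ) • (1 : FermionOp Λ') -
        ∑ σ : Fin 2, ((μA σ : ℝ) : ℂ) • (nAt 0 hz σ - ((νA : ℝ) : ℂ) • (1 : FermionOp Λ')) -
        (((κA : ℚ) : ℝ) : ℂ) • ((((cA : ℚ) : ℝ) : ℂ) • (1 : FermionOp Λ') -
          fermionEmbed (PolySite.incl h0) ((hubbardTTPrimeFermionInteraction 1 sA U).meanEnergyObs 1)) -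
        (((κA' : ℚ) : ℝ) : ℂ) • (fermionEmbed (PolySite.incl h0) ((hubbardTTPrimeFermionInteraction 1 sA U).meanEnergyObs 1) -
          (((flA : ℚ) : ℝ) : ℂ) • (1 : FermionOp Λ')) =
      gramForm ΛmA OA +
        (∑ k ∈ sE, ((hubbardTTPrimeFermionInteraction 1 sA U).localHamiltonian Λ' *
              fermionEmbed (PolySite.incl hΛ) (B k) -
            fermionEmbed (PolySite.incl hΛ) (B k) *
              (hubbardTTPrimeFermionInteraction 1 sA U).localHamiltonian Λ') +
          ∑ l ∈ ttA, (fermionEmbed (PolySite.incl (hshA l)) (fermionEmbed (PolySite.d4Emb (γA l) (wvA l) Λ) (YA l)) -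
            fermionEmbed (PolySite.incl hΛ) (YA l)) +
          ∑ j ∈ uuA, bA j • ladderWord (cwA j)) +
        (∑ m' ∈ ahA, ((dcA m' : ℝ) : ℂ) • ((VA m')ᴴ - VA m') + ∑ k ∈ wA, aA k • ladderWord (wordA k)))
    (hβA : ((βA : ℚ) : ℝ) ≤ c0A - ∑ k ∈ wA, ‖aA k‖ + (∑ σ : Fin 2, μA σ) * (((n₀ : ℚ) : ℝ) / 2 - νA))
    (hslA : ((slA : ℚ) : ℝ) = (∑ σ : Fin 2, μA σ) / 2)
    -- vertex B
    (μB : Fin 2 → ℝ) (νB : ℝ)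
    {mB : Type*} [Fintype mB] [DecidableEq mB] {ΛmB : Matrix mB mB ℂ} (hΛmB : ΛmB.PosSemidef)
    (OB : mB → FermionOp Λ')
    {ιB : Type*} (ttB : Finset ιB) (γB : ιB → DihedralGroup 4) (wvB : ιB → Site 2)
    (hshB : ∀ l, d4ShiftSet (γB l) (wvB l) Λ ⊆ Λ') (YB : ιB → FermionOp Λ)
    {ρB : Type*} (uuB : Finset ρB) (bB : ρB → ℂ) (cwB : ρB → List (Orb (PolySite Λ') × Bool))
    (hcwB : ∀ j ∈ uuB, ladderCharge (cwB j) ≠ 0 ∨ ladderSpinCharge (cwB j) ≠ 0)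
    {δB : Type*} (ahB : Finset δB) (dcB : δB → ℝ) (VB : δB → FermionOp Λ')
    {κB'' : Type*} (wB : Finset κB'') (aB : κB'' → ℂ) (wordB : κB'' → List (Orb (PolySite Λ') × Bool))
    {c0B : ℝ}
    (hcertB : fermionEmbed (PolySite.incl h7) (X sB) - (c0B : ℂ) • (1 : FermionOp Λ') -
        ∑ σ : Fin 2, ((μB σ : ℝ) : ℂ) • (nAt 0 hz σ - ((νB : ℝ) : ℂ) • (1 : FermionOp Λ')) -
        (((κB : ℚ) : ℝ) : ℂ) • ((((cB : ℚ) : ℝ) : ℂ) • (1 : FermionOp Λ') -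
          fermionEmbed (PolySite.incl h0) ((hubbardTTPrimeFermionInteraction 1 sB U).meanEnergyObs 1)) -
        (((κB' : ℚ) : ℝ) : ℂ) • (fermionEmbed (PolySite.incl h0) ((hubbardTTPrimeFermionInteraction 1 sB U).meanEnergyObs 1) -
          (((flB : ℚ) : ℝ) : ℂ) • (1 : FermionOp Λ')) =
      gramForm ΛmB OB +
        (∑ k ∈ sE, ((hubbardTTPrimeFermionInteraction 1 sB U).localHamiltonian Λ' *
              fermionEmbed (PolySite.incl hΛ) (B k) -
            fermionEmbed (PolySite.incl hΛ) (B k) *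
              (hubbardTTPrimeFermionInteraction 1 sB U).localHamiltonian Λ') +
          ∑ l ∈ ttB, (fermionEmbed (PolySite.incl (hshB l)) (fermionEmbed (PolySite.d4Emb (γB l) (wvB l) Λ) (YB l)) -
            fermionEmbed (PolySite.incl hΛ) (YB l)) +
          ∑ j ∈ uuB, bB j • ladderWord (cwB j)) +
        (∑ m' ∈ ahB, ((dcB m' : ℝ) : ℂ) • ((VB m')ᴴ - VB m') + ∑ k ∈ wB, aB k • ladderWord (wordB k)))
    (hβB : ((βB : ℚ) : ℝ) ≤ c0B - ∑ k ∈ wB, ‖aB k‖ + (∑ σ : Fin 2, μB σ) * (((n₀ : ℚ) : ℝ) / 2 - νB))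
    (hslB : ((slB : ℚ) : ℝ) = (∑ σ : Fin 2, μB σ) / 2) :
    TPrimePinnedPairFamilyRowWN U sA sB cA cB flA flB βA κA κA' slA βB κB κB' slB n₀ X := by
  have h1S : (1 : DihedralGroup 4) ∈ (Finset.univ : Finset (DihedralGroup 4)) := Finset.mem_univ _
  have hmulS : ∀ a ∈ (Finset.univ : Finset (DihedralGroup 4)), ∀ b ∈ (Finset.univ : Finset (DihedralGroup 4)),
      a * b ∈ (Finset.univ : Finset (DihedralGroup 4)) := fun _ _ _ _ => Finset.mem_univ _
  refine ⟨fun ω => ((Finset.univ : Finset (DihedralGroup 4)).card : ℝ)⁻¹ * ∑ g ∈ (Finset.univ : Finset (DihedralGroup 4)),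
      (ω.expect (d4ShiftSet g 0 Λ')
        (fermionEmbed (PolySite.d4Emb g 0 Λ')
          (∑ k ∈ sE, ((hubbardTTPrimeFermionInteraction 1 0 U).localHamiltonian Λ' *
              fermionEmbed (PolySite.incl hΛ) (B k) -
            fermionEmbed (PolySite.incl hΛ) (B k) *
              (hubbardTTPrimeFermionInteraction 1 0 U).localHamiltonian Λ')))).re,
    fun ω => ((Finset.univ : Finset (DihedralGroup 4)).card : ℝ)⁻¹ * ∑ g ∈ (Finset.univ : Finset (DihedralGroup 4)),
      (ω.expect (d4ShiftSet g 0 Λ')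
        (fermionEmbed (PolySite.d4Emb g 0 Λ')
          (∑ k ∈ sE, ((hubbardTTPrimeFermionInteraction 0 1 0).localHamiltonian Λ' *
              fermionEmbed (PolySite.incl hΛ) (B k) -
            fermionEmbed (PolySite.incl hΛ) (B k) *
              (hubbardTTPrimeFermionInteraction 0 1 0).localHamiltonian Λ')))).re,
    fun s _ x hx0 hx2 ω Ls ψ hLs hψ hψ1 hω => ⟨?_, ?_, ?_⟩⟩
  · exact pinnedStationarity hU hx0 hx2 s hΛ h8 h0 hz h1S hmulS sE B hLs hψ hψ1 hω
  · have h := pinnedVertexRow_of_windowIdentity hU hx0 hx2 sA s hΛ h8 h0 hz h1S hmulS (fermionEmbed (PolySite.incl h7) (X sA)) μA νA cA flA κA κA' hΛmA OA sE B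
      ttA γA (fun _ _ => Finset.mem_univ _) wvA hshA YA uuA bA cwA hcwA ahA dcA VA wA aA wordA hcertA hLs hψ hψ1 hω
    simp_rw [expect_d4Emb_fermionEmbed_incl ω h7] at h
    have hGS : ω.meanEnergy (hubbardTTPrimeFermionInteraction 1 s U) 1 = energyDensityTT' 1 s U x :=
      hω.meanEnergy_hubbardTTPrime_eq_energyDensityTT' 1 s hU hx0 hx2 hLs hψ hψ1
    have hEA : ω.meanEnergy (hubbardTTPrimeFermionInteraction 1 sA U) 1 =
        energyDensityTT' 1 s U x + (sA - s) * ω.meanEnergy (hubbardTTPrimeFermionInteraction 0 1 0) 1 := by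
      rw [ω.meanEnergy_hubbardTTPrime_affine 1 s U sA U, hGS]; ring
    have hμ : ((slA : ℚ) : ℝ) * (x - ((n₀ : ℚ) : ℝ)) + (∑ σ : Fin 2, μA σ) * (((n₀ : ℚ) : ℝ) / 2 - νA) =
        (∑ σ : Fin 2, μA σ) * (x / 2 - νA) := by rw [hslA]; ring
    unfold tPrimeObjOrbitMean
    rw [hEA]
    dsimp only
    have e1 : ((κA : ℚ) : ℝ) * (((cA : ℚ) : ℝ) - (energyDensityTT' 1 s U x + (sA - s) * ω.meanEnergy (hubbardTTPrimeFermionInteraction 0 1 0) 1)) =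
        ((κA : ℚ) : ℝ) * (((cA : ℚ) : ℝ) - energyDensityTT' 1 s U x + (s - sA) * ω.meanEnergy (hubbardTTPrimeFermionInteraction 0 1 0) 1) := by ring
    have e2 : ((κA' : ℚ) : ℝ) * (energyDensityTT' 1 s U x + (sA - s) * ω.meanEnergy (hubbardTTPrimeFermionInteraction 0 1 0) 1 - ((flA : ℚ) : ℝ)) =
        ((κA' : ℚ) : ℝ) * (energyDensityTT' 1 s U x - (s - sA) * ω.meanEnergy (hubbardTTPrimeFermionInteraction 0 1 0) 1 - ((flA : ℚ) : ℝ)) := by ring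
    linarith [h, hμ, hβA, e1, e2]
  · have h := pinnedVertexRow_of_windowIdentity hU hx0 hx2 sB s hΛ h8 h0 hz h1S hmulS (fermionEmbed (PolySite.incl h7) (X sB)) μB νB cB flB κB κB' hΛmB OB sE B
      ttB γB (fun _ _ => Finset.mem_univ _) wvB hshB YB uuB bB cwB hcwB ahB dcB VB wB aB wordB hcertB hLs hψ hψ1 hω
    simp_rw [expect_d4Emb_fermionEmbed_incl ω h7] at h
    have hGS : ω.meanEnergy (hubbardTTPrimeFermionInteraction 1 s U) 1 = energyDensityTT' 1 s U x :=
      hω.meanEnergy_hubbardTTPrime_eq_energyDensityTT' 1 s hU hx0 hx2 hLs hψ hψ1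
    have hEB : ω.meanEnergy (hubbardTTPrimeFermionInteraction 1 sB U) 1 =
        energyDensityTT' 1 s U x + (sB - s) * ω.meanEnergy (hubbardTTPrimeFermionInteraction 0 1 0) 1 := by
      rw [ω.meanEnergy_hubbardTTPrime_affine 1 s U sB U, hGS]; ring
    have hμ : ((slB : ℚ) : ℝ) * (x - ((n₀ : ℚ) : ℝ)) + (∑ σ : Fin 2, μB σ) * (((n₀ : ℚ) : ℝ) / 2 - νB) =
        (∑ σ : Fin 2, μB σ) * (x / 2 - νB) := by rw [hslB]; ring
    unfold tPrimeObjOrbitMean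
    rw [hEB]
    dsimp only
    have e1 : ((κB : ℚ) : ℝ) * (((cB : ℚ) : ℝ) - (energyDensityTT' 1 s U x + (sB - s) * ω.meanEnergy (hubbardTTPrimeFermionInteraction 0 1 0) 1)) =
        ((κB : ℚ) : ℝ) * (((cB : ℚ) : ℝ) - energyDensityTT' 1 s U x + (s - sB) * ω.meanEnergy (hubbardTTPrimeFermionInteraction 0 1 0) 1) := by ring
    have e2 : ((κB' : ℚ) : ℝ) * (energyDensityTT' 1 s U x + (sB - s) * ω.meanEnergy (hubbardTTPrimeFermionInteraction 0 1 0) 1 - ((flB : ℚ) : ℝ)) =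
        ((κB' : ℚ) : ℝ) * (energyDensityTT' 1 s U x - (s - sB) * ω.meanEnergy (hubbardTTPrimeFermionInteraction 0 1 0) 1 - ((flB : ℚ) : ℝ)) := by ring
    linarith [h, hμ, hβB, e1, e2]


end IdentityWide

/-! ## §2 Semantic-residual level, wide window (abstract Gram slots) -/

section ResidPolyWide

variable {α β : Type*}

/-- **WN-FAMILY PAIR NODE‴ FROM TWO SEMANTIC RESIDUALS ON A LARGER LETTER WINDOW `Λ' ⊇ box 2 7`** (objectives the embedded words `Γ(incl h7)(X s_v)`;
abstract Gram slots, ONE shared `EB`; per vertex `hR_v : evalPoly d R_v = termOp d (residTG …_v)`). [cite: WangEtAl2024, §III] [cite: JanssonChaykinKeil2008, §3] -/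
theorem TPrimePinnedPairFamilyRowWN.of_residPolys_wide
    (U : ℚ) (hU : 0 ≤ U) (n₀ sA sB : ℚ)
    {Λ Λ' : Finset (Site 2)} (h7 : Literature.Probability.LatticeModels.box 2 7 ⊆ Λ') (hΛ : Λ ⊆ Λ') (h8 : thicken Λ 1 ⊆ Λ')
    (h0 : thicken ({0} : Finset (Site 2)) 1 ⊆ Λ') (hz : (0 : Site 2) ∈ Λ')
    -- letters (shared)
    (d : α → Orb (PolySite Λ'))
    (dΛ : β → Orb (PolySite Λ)) (f : β → α) (hf : ∀ b, d (f b) = Orb.embMap (PolySite.incl hΛ) (dΛ b))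
    (sp : α → Fin 2) (hsp : ∀ a, (ofLex (d a)).2 = sp a)
    (o : Fin 2 → α) (ho : ∀ σ, d (o σ) = orb (PolySite.pt 0 hz) σ)
    -- the objective family and the SHARED eom words
    (X : ℝ → FermionOp (Literature.Probability.LatticeModels.box 2 7)) (EB : List (Terms β))
    -- vertex A
    (THA : Terms α) (hHA : termOp d THA = (hubbardTTPrimeFermionInteraction 1 (sA : ℝ) (U : ℝ)).localHamiltonian Λ')
    (TEA : Terms α)
    (hEA : termOp d TEA = fermionEmbed (PolySite.incl h0) ((hubbardTTPrimeFermionInteraction 1 (sA : ℝ) (U : ℝ)).meanEnergyObs 1))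
    (TXA : Terms α) (hXA : termOp d TXA = fermionEmbed (PolySite.incl h7) (X (sA : ℝ))) (μA : Fin 2 → ℚ) (νA κA capA κA' flA : ℚ)
    (TGA : Terms α) {mA : Type*} [Fintype mA] [DecidableEq mA] {ΛmA : Matrix mA mA ℂ} (hΛmA : ΛmA.PosSemidef)
    (OA : mA → FermionOp Λ') (hGA : termOp d TGA = gramForm ΛmA OA)
    {nSA : ℕ} (γA : Fin nSA → DihedralGroup 4) (wvA : Fin nSA → Site 2) (hshA : ∀ l, d4ShiftSet (γA l) (wvA l) Λ ⊆ Λ')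
    (gA : Fin nSA → β → α)
    (hgA : ∀ l b, d (gA l b) = Orb.embMap (PolySite.incl (hshA l)) (Orb.embMap (PolySite.d4Emb (γA l) (wvA l) Λ) (dΛ b)))
    (SYA : Fin nSA → Terms β) (CWA : Terms α) (hcwA : ∀ wc ∈ CWA, chargeW wc.1 ≠ 0 ∨ spinChargeW sp wc.1 ≠ 0) (AVA : List (Terms α))
    {RA : CARPoly.Poly α}
    (hRA : evalPoly d RA = termOp d (residTG TXA μA νA o κA capA κA' flA TEA TGA THA f EB gA SYA CWA AVA))
    {βA : ℚ} (hβA : βA ≤ lowerConst RA + (μA 0 + μA 1) * (n₀ / 2 - νA)) {slA : ℚ} (hslA : slA = (μA 0 + μA 1) / 2)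
    -- vertex B
    (THB : Terms α) (hHB : termOp d THB = (hubbardTTPrimeFermionInteraction 1 (sB : ℝ) (U : ℝ)).localHamiltonian Λ')
    (TEB : Terms α)
    (hEB : termOp d TEB = fermionEmbed (PolySite.incl h0) ((hubbardTTPrimeFermionInteraction 1 (sB : ℝ) (U : ℝ)).meanEnergyObs 1))
    (TXB : Terms α) (hXB : termOp d TXB = fermionEmbed (PolySite.incl h7) (X (sB : ℝ))) (μB : Fin 2 → ℚ) (νB κB capB κB' flB : ℚ)
    (TGB : Terms α) {mB : Type*} [Fintype mB] [DecidableEq mB] {ΛmB : Matrix mB mB ℂ} (hΛmB : ΛmB.PosSemidef)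
    (OB : mB → FermionOp Λ') (hGB : termOp d TGB = gramForm ΛmB OB)
    {nSB : ℕ} (γB : Fin nSB → DihedralGroup 4) (wvB : Fin nSB → Site 2) (hshB : ∀ l, d4ShiftSet (γB l) (wvB l) Λ ⊆ Λ')
    (gB : Fin nSB → β → α)
    (hgB : ∀ l b, d (gB l b) = Orb.embMap (PolySite.incl (hshB l)) (Orb.embMap (PolySite.d4Emb (γB l) (wvB l) Λ) (dΛ b)))
    (SYB : Fin nSB → Terms β) (CWB : Terms α) (hcwB : ∀ wc ∈ CWB, chargeW wc.1 ≠ 0 ∨ spinChargeW sp wc.1 ≠ 0) (AVB : List (Terms α))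
    {RB : CARPoly.Poly α}
    (hRB : evalPoly d RB = termOp d (residTG TXB μB νB o κB capB κB' flB TEB TGB THB f EB gB SYB CWB AVB))
    {βB : ℚ} (hβB : βB ≤ lowerConst RB + (μB 0 + μB 1) * (n₀ / 2 - νB)) {slB : ℚ} (hslB : slB = (μB 0 + μB 1) / 2) :
    TPrimePinnedPairFamilyRowWN (U : ℝ) (sA : ℝ) (sB : ℝ) capA capB flA flB βA κA κA' slA βB κB κB' slB n₀ X := by
  have hUr : (0 : ℝ) ≤ ((U : ℚ) : ℝ) := by exact_mod_cast hU
  -- (1) the two window identities from the SEMANTIC residual hypotheses, on the objectives `X sA`, `X sB`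
  have hcertA := windowIdentity_of_residPoly hΛ hz d dΛ f hf THA _ hHA TEA _ hEA o ho TXA μA νA κA capA κA' flA TGA ΛmA OA hGA EB
    γA wvA hshA gA hgA SYA CWA AVA hRA
  rw [hXA] at hcertA
  have hcertB := windowIdentity_of_residPoly hΛ hz d dΛ f hf THB _ hHB TEB _ hEB o ho TXB μB νB κB capB κB' flB TGB ΛmB OB hGB EB
    γB wvB hshB gB hgB SYB CWB AVB hRB
  rw [hXB] at hcertB
  -- (2) the charged words are charged (decided on the syntax)
  have hcwA' := charged_of_hcw d sp hsp CWA hcwA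
  have hcwB' := charged_of_hcw d sp hsp CWB hcwB
  -- (3) the prices are `lowerConst R_v` (valid for ANY polynomial denoting the residual); the filling slopes are half the density multipliers
  have hβA' : ((βA : ℚ) : ℝ) ≤ ((constCoeff RA : ℚ) : ℝ) - ∑ k ∈ (Finset.univ : Finset (Fin RA.length)), ‖resCoeff RA k‖ +
      (∑ σ : Fin 2, ((μA σ : ℚ) : ℝ)) * (((n₀ : ℚ) : ℝ) / 2 - ((νA : ℚ) : ℝ)) := by
    rw [constCoeff_sub_sum_norm_resCoeff RA, Fin.sum_univ_two]
    have h2 : ((βA : ℚ) : ℝ) ≤ (((lowerConst RA + (μA 0 + μA 1) * (n₀ / 2 - νA) : ℚ)) : ℝ) := by exact_mod_cast hβA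
    push_cast at h2
    linarith
  have hβB' : ((βB : ℚ) : ℝ) ≤ ((constCoeff RB : ℚ) : ℝ) - ∑ k ∈ (Finset.univ : Finset (Fin RB.length)), ‖resCoeff RB k‖ +
      (∑ σ : Fin 2, ((μB σ : ℚ) : ℝ)) * (((n₀ : ℚ) : ℝ) / 2 - ((νB : ℚ) : ℝ)) := by
    rw [constCoeff_sub_sum_norm_resCoeff RB, Fin.sum_univ_two]
    have h2 : ((βB : ℚ) : ℝ) ≤ (((lowerConst RB + (μB 0 + μB 1) * (n₀ / 2 - νB) : ℚ)) : ℝ) := by exact_mod_cast hβB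
    push_cast at h2
    linarith
  have hslA' : ((slA : ℚ) : ℝ) = (∑ σ : Fin 2, ((μA σ : ℚ) : ℝ)) / 2 := by
    rw [Fin.sum_univ_two, hslA]; push_cast; ring
  have hslB' : ((slB : ℚ) : ℝ) = (∑ σ : Fin 2, ((μB σ : ℚ) : ℝ)) / 2 := by
    rw [Fin.sum_univ_two, hslB]; push_cast; ring
  -- (4) the identity-level pair theorem (density-affine family edition), with the SHARED eom words `B_k := termOp dΛ (EB.get k)`
  exact TPrimePinnedPairFamilyRowWN.of_window_certificates_wide hUr X h7 hΛ h8 h0 hz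
    (Finset.univ : Finset (Fin EB.length)) (fun k => termOp dΛ (EB.get k))
    (fun σ => ((μA σ : ℚ) : ℝ)) ((νA : ℚ) : ℝ) hΛmA OA Finset.univ γA wvA hshA (fun l => termOp dΛ (SYA l))
    Finset.univ (fun j => (((CWA.get j).2 : ℚ) : ℂ)) (fun j => wmap d (CWA.get j).1) hcwA' Finset.univ (fun _ => (1 : ℝ))
    (fun m' => termOp d (AVA.get m')) Finset.univ (resCoeff RA) (resWord d RA) hcertA hβA' hslA'
    (fun σ => ((μB σ : ℚ) : ℝ)) ((νB : ℚ) : ℝ) hΛmB OB Finset.univ γB wvB hshB (fun l => termOp dΛ (SYB l))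
    Finset.univ (fun j => (((CWB.get j).2 : ℚ) : ℂ)) (fun j => wmap d (CWB.get j).1) hcwB' Finset.univ (fun _ => (1 : ℝ))
    (fun m' => termOp d (AVB.get m')) Finset.univ (resCoeff RB) (resWord d RB) hcertB hβB' hslB'

/-- **CONSTANT-OBJECTIVE WN PAIR NODE‴ FROM TWO SEMANTIC RESIDUALS ON `Λ' ⊇ box 2 7`** (`TPrimePinnedPairRowWN … X₀`; objective `Γ(incl h7) X₀` at
both vertices), via `TPrimePinnedPairRowWN_iff_family`. [cite: WangEtAl2024, §III] [cite: JanssonChaykinKeil2008, §3] -/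
theorem TPrimePinnedPairRowWN.of_residPolys_wide
    (U : ℚ) (hU : 0 ≤ U) (n₀ sA sB : ℚ)
    {Λ Λ' : Finset (Site 2)} (h7 : Literature.Probability.LatticeModels.box 2 7 ⊆ Λ') (hΛ : Λ ⊆ Λ') (h8 : thicken Λ 1 ⊆ Λ')
    (h0 : thicken ({0} : Finset (Site 2)) 1 ⊆ Λ') (hz : (0 : Site 2) ∈ Λ')
    (d : α → Orb (PolySite Λ'))
    (dΛ : β → Orb (PolySite Λ)) (f : β → α) (hf : ∀ b, d (f b) = Orb.embMap (PolySite.incl hΛ) (dΛ b))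
    (sp : α → Fin 2) (hsp : ∀ a, (ofLex (d a)).2 = sp a)
    (o : Fin 2 → α) (ho : ∀ σ, d (o σ) = orb (PolySite.pt 0 hz) σ)
    (X₀ : FermionOp (Literature.Probability.LatticeModels.box 2 7)) (EB : List (Terms β))
    -- vertex A
    (THA : Terms α) (hHA : termOp d THA = (hubbardTTPrimeFermionInteraction 1 (sA : ℝ) (U : ℝ)).localHamiltonian Λ')
    (TEA : Terms α)
    (hEA : termOp d TEA = fermionEmbed (PolySite.incl h0) ((hubbardTTPrimeFermionInteraction 1 (sA : ℝ) (U : ℝ)).meanEnergyObs 1))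
    (TXA : Terms α) (hXA : termOp d TXA = fermionEmbed (PolySite.incl h7) X₀) (μA : Fin 2 → ℚ) (νA κA capA κA' flA : ℚ)
    (TGA : Terms α) {mA : Type*} [Fintype mA] [DecidableEq mA] {ΛmA : Matrix mA mA ℂ} (hΛmA : ΛmA.PosSemidef)
    (OA : mA → FermionOp Λ') (hGA : termOp d TGA = gramForm ΛmA OA)
    {nSA : ℕ} (γA : Fin nSA → DihedralGroup 4) (wvA : Fin nSA → Site 2) (hshA : ∀ l, d4ShiftSet (γA l) (wvA l) Λ ⊆ Λ')
    (gA : Fin nSA → β → α)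
    (hgA : ∀ l b, d (gA l b) = Orb.embMap (PolySite.incl (hshA l)) (Orb.embMap (PolySite.d4Emb (γA l) (wvA l) Λ) (dΛ b)))
    (SYA : Fin nSA → Terms β) (CWA : Terms α) (hcwA : ∀ wc ∈ CWA, chargeW wc.1 ≠ 0 ∨ spinChargeW sp wc.1 ≠ 0) (AVA : List (Terms α))
    {RA : CARPoly.Poly α}
    (hRA : evalPoly d RA = termOp d (residTG TXA μA νA o κA capA κA' flA TEA TGA THA f EB gA SYA CWA AVA))
    {βA : ℚ} (hβA : βA ≤ lowerConst RA + (μA 0 + μA 1) * (n₀ / 2 - νA)) {slA : ℚ} (hslA : slA = (μA 0 + μA 1) / 2)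
    -- vertex B
    (THB : Terms α) (hHB : termOp d THB = (hubbardTTPrimeFermionInteraction 1 (sB : ℝ) (U : ℝ)).localHamiltonian Λ')
    (TEB : Terms α)
    (hEB : termOp d TEB = fermionEmbed (PolySite.incl h0) ((hubbardTTPrimeFermionInteraction 1 (sB : ℝ) (U : ℝ)).meanEnergyObs 1))
    (TXB : Terms α) (hXB : termOp d TXB = fermionEmbed (PolySite.incl h7) X₀) (μB : Fin 2 → ℚ) (νB κB capB κB' flB : ℚ)
    (TGB : Terms α) {mB : Type*} [Fintype mB] [DecidableEq mB] {ΛmB : Matrix mB mB ℂ} (hΛmB : ΛmB.PosSemidef)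
    (OB : mB → FermionOp Λ') (hGB : termOp d TGB = gramForm ΛmB OB)
    {nSB : ℕ} (γB : Fin nSB → DihedralGroup 4) (wvB : Fin nSB → Site 2) (hshB : ∀ l, d4ShiftSet (γB l) (wvB l) Λ ⊆ Λ')
    (gB : Fin nSB → β → α)
    (hgB : ∀ l b, d (gB l b) = Orb.embMap (PolySite.incl (hshB l)) (Orb.embMap (PolySite.d4Emb (γB l) (wvB l) Λ) (dΛ b)))
    (SYB : Fin nSB → Terms β) (CWB : Terms α) (hcwB : ∀ wc ∈ CWB, chargeW wc.1 ≠ 0 ∨ spinChargeW sp wc.1 ≠ 0) (AVB : List (Terms α))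
    {RB : CARPoly.Poly α}
    (hRB : evalPoly d RB = termOp d (residTG TXB μB νB o κB capB κB' flB TEB TGB THB f EB gB SYB CWB AVB))
    {βB : ℚ} (hβB : βB ≤ lowerConst RB + (μB 0 + μB 1) * (n₀ / 2 - νB)) {slB : ℚ} (hslB : slB = (μB 0 + μB 1) / 2) :
    TPrimePinnedPairRowWN (U : ℝ) (sA : ℝ) (sB : ℝ) capA capB flA flB βA κA κA' slA βB κB κB' slB n₀ X₀ :=
  (TPrimePinnedPairRowWN_iff_family).2
    (TPrimePinnedPairFamilyRowWN.of_residPolys_wide U hU n₀ sA sB h7 hΛ h8 h0 hz d dΛ f hf sp hsp o ho (fun _ => X₀) EB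
      THA hHA TEA hEA TXA hXA μA νA κA capA κA' flA TGA hΛmA OA hGA γA wvA hshA gA hgA SYA CWA hcwA AVA hRA hβA hslA
      THB hHB TEB hEB TXB hXB μB νB κB capB κB' flB TGB hΛmB OB hGB γB wvB hshB gB hgB SYB CWB hcwB AVB hRB hβB hslB)

end ResidPolyWide

end Summit.Ventures.CertifiedManyBodySolver.Downfold

end
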